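import Summits.AnomalousDissipation.AnomalousDissipation.Theorems.SolenoidalFractalHomogenisationLagrangianStepCellChainSlotWindowFrame
import Summits.AnomalousDissipation.AnomalousDissipation.Theorems.SolenoidalFractalHomogenisationLagrangianStepCellChainPairFrame
import Summits.AnomalousDissipation.AnomalousDissipation.Theorems.SolenoidalFractalHomogenisationLagrangianStepCellChainSlotStepInputs
import HarnessLib

/-!
# K1L_D (stmt-AnomalousDissipation-27980), (ℓ3) (D-TH)₀ — W7 engine sub-piece S1a AT A FROZEN FRAME `G₀`: the INPUTS of `W7Slot.slot_stepR` on one slot window,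
# in its exact hypothesis shapes (helper; `--supports stmt-AnomalousDissipation-27980 --as helper`)

Port plan B8 (`HOME/ad-sawtooth-k1loc-p1/g16/W7thg-portplan-k1locp1g16.md`; prover ad-sawtooth-k1loc-p1 g16): the frozen-frame twin of w1's flat
`…CellChainSlotStepInputs` under the dictionary `transversalProj k ↦ transversalProjR (twistFreq G₀ k)`, `kdot k ↦ rdot (twistFreq G₀ k)`, `modeRep ↦ modeRepθ`,
`modalAdjGen 𝔹ᵀ K w ↦ 4π² • P^θ_K T_{(𝔹^{G₀})ᵀ}(K) w`, `dW0C/dWpC/dWmC ↦ dW0R/dWpR/dWmR`, `NearIso`-coercivity ↦ the a.e. coercivity HYPOTHESIS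
`loc·|k|²‖û(k)‖² ≤ Re⟪û(k), T_{𝔹^{G₀}}(k) û(k)⟫` of w1's `exists_energyRep_cell_frame` (`loc = lo'·c₀`).  On the absolute window `[t₀, t₁] = [pP + start s,
pP + start s + τ_s] ⊆ [0,T]` of slot `s` in period `p` of the word `W₁` driving the distorted cell problem
`IsWeakTensorPassiveVectorDistortedOn 0 T 𝔹 (W₁.cell n) (fun _ _ => G₀) F u`, with the five gauged representatives `wⱼ t = μ^j • modeRepθ … (K₀ + j·K_s) t`:
twisted transversality on `[0,T]` (`rdot_gauge_modeRepθ`), absolute continuity (`absolutelyContinuousOnInterval_gauge_modeRepθ`), the chain ODE on `uIcc t₀ t₁`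
(`ae_uIcc_hasDerivAt_dW0R_frame/_dWpR_frame/_dWmR_frame`, link `c_s·A(t)`), the five-mode energy sandwich EVERYWHERE on `[0,T]` (`five_norm_sq_le_energy_frame`)
and the conjugate-pair dissipation split on `uIcc t₀ t₁` in the five-term order of `slot_stepR` (`ae_uIcc_pair_split_frame`).  The frame-free tools of the flat
file (§0 `ae_uIcc_of_ae_window`, `ae_uIcc_of_ae_Ioo`, `le_on_Icc_of_ae_le`, §2 `ae_uIcc_hasDerivAt_energy`, §4 `sum_window_pair_eq`, `sum_S5_eq`) are reused BY NAME.
Everything proved; no definitions, no named facts, no sorry.  NOT a proof of `stub_W7thg`, of K1L_D or of AD; rung F-D1.A0 infrastructure.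
[cite: BedrossianCotiZelati2017, §2] [cite: Temam1984, Ch. III §1.1] [problem: turb]
-/

set_option linter.dupNamespace false

noncomputable section

namespace Summit.AnomalousDissipation.AnomalousDissipation.Theorems.SolenoidalFractalHomogenisation.LagrangianStep.CellChain

open Set MeasureTheory Filter Topology Function Complex UnitAddTorus
open scoped InnerProductSpace ComplexConjugate ENNReal
open Literature.Analysis Literature.Analysis.FunctionSpaces Literature.Analysis.FunctionSpaces.Torus
open Literature.Analysis.FluidPDE Literature.Analysis.FluidPDE.Torus Literature.Analysis.FluidPDE.LatticeShear
open Summit.AnomalousDissipation.AnomalousDissipation.Theorems.SolenoidalFractalHomogenisation.RealisedQuasiStaticCellLaw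
open Summit.AnomalousDissipation.AnomalousDissipation.Theorems.SolenoidalFractalHomogenisation.PermissibleCarrier
open Summit.AnomalousDissipation.AnomalousDissipation.Theorems.SolenoidalFractalHomogenisation.LagrangianStep.ThreeMode

variable {k₀ : ℕ}

/-! ## §1 Twisted transversality and absolute continuity of the gauged representatives -/

/-- `rdot (G₀ᵀK) (c • modeRepθ … K t) = 0` on `[0,T]`. [cite: Temam1984, Ch. III §1.1] -/
theorem rdot_gauge_modeRepθ (W₁ : LatticeWord k₀) (n : ℕ) {T : ℝ} (hT : 0 ≤ T) {𝔹 : Torus.Visc4 (Fin 3)}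
    {G₀ : Matrix (Fin 3) (Fin 3) ℝ} {F : UnitAddTorus (Fin 3) → EuclideanSpace ℝ (Fin 3)} {u : ℝ → UnitAddTorus (Fin 3) → EuclideanSpace ℝ (Fin 3)}
    (h : Torus.IsWeakTensorPassiveVectorDistortedOn 0 T 𝔹 (W₁.cell n) (fun _ _ => G₀) F u) (c : ℂ) (K : Fin 3 → ℤ) {t : ℝ} (ht : t ∈ Icc 0 T) :
    Torus.rdot (Torus.twistFreq G₀ K) (c • modeRepθ W₁ n 𝔹 G₀ F u K t) = 0 := by
  have h1 := rdot_modeRepθ W₁ n hT h K ht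
  rw [LinearMap.map_smul, h1, smul_zero]

/-- `t ↦ c • modeRepθ … K t` is absolutely continuous on every `[t₀,t₁] ⊆ [0,T]`. [cite: Temam1984, Ch. III §1.1] -/
theorem absolutelyContinuousOnInterval_gauge_modeRepθ (W₁ : LatticeWord k₀) (n : ℕ) {T : ℝ} (hT : 0 ≤ T) {𝔹 : Torus.Visc4 (Fin 3)}
    {G₀ : Matrix (Fin 3) (Fin 3) ℝ} {F : UnitAddTorus (Fin 3) → EuclideanSpace ℝ (Fin 3)} {u : ℝ → UnitAddTorus (Fin 3) → EuclideanSpace ℝ (Fin 3)}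
    (h : Torus.IsWeakTensorPassiveVectorDistortedOn 0 T 𝔹 (W₁.cell n) (fun _ _ => G₀) F u) (c : ℂ) (K : Fin 3 → ℤ) {t₀ t₁ : ℝ} (ht₀ : t₀ ∈ Icc 0 T)
    (ht₁ : t₁ ∈ Icc 0 T) :
    AbsolutelyContinuousOnInterval (fun t => c • modeRepθ W₁ n 𝔹 G₀ F u K t) t₀ t₁ :=
  (absolutelyContinuousOnInterval_modeRepθ W₁ n hT h K ht₀ ht₁).const_smul c

/-- `t ↦ c • modeRepθ … K t` is continuous on `[0,T]`, and so is the square of its norm. [cite: Temam1984, Ch. III §1.1] -/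
theorem continuousOn_norm_sq_gauge_modeRepθ (W₁ : LatticeWord k₀) (n : ℕ) {T : ℝ} (hT : 0 ≤ T) {𝔹 : Torus.Visc4 (Fin 3)}
    {G₀ : Matrix (Fin 3) (Fin 3) ℝ} {F : UnitAddTorus (Fin 3) → EuclideanSpace ℝ (Fin 3)} {u : ℝ → UnitAddTorus (Fin 3) → EuclideanSpace ℝ (Fin 3)}
    (h : Torus.IsWeakTensorPassiveVectorDistortedOn 0 T 𝔹 (W₁.cell n) (fun _ _ => G₀) F u) (c : ℂ) (K : Fin 3 → ℤ) :
    ContinuousOn (fun t => ‖c • modeRepθ W₁ n 𝔹 G₀ F u K t‖ ^ 2) (Icc 0 T) := by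
  have h1 : ContinuousOn (fun t => c • modeRepθ W₁ n 𝔹 G₀ F u K t) (Icc 0 T) := (continuousOn_modeRepθ W₁ n hT h K).const_smul c
  exact h1.norm.pow 2

/-! ## §3 The twisted chain ODE on `uIcc t₀ t₁` (slot_stepR's `hd0' / hdp' / hdm'`) -/

/-- `hd0` of `slot_step` on the window of slot `s`, period `p` (`[t₀,t₁] ⊆ [0,T]`). [cite: BedrossianCotiZelati2017, §2 (hypocoercivity functional with a cross term)] -/
theorem ae_uIcc_hasDerivAt_dW0R_frame (W₁ : LatticeWord k₀) (n : ℕ) {T : ℝ} (hT : 0 ≤ T) {𝔹 : Torus.Visc4 (Fin 3)}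
    {G₀ : Matrix (Fin 3) (Fin 3) ℝ} {F : UnitAddTorus (Fin 3) → EuclideanSpace ℝ (Fin 3)} {u : ℝ → UnitAddTorus (Fin 3) → EuclideanSpace ℝ (Fin 3)}
    (h : Torus.IsWeakTensorPassiveVectorDistortedOn 0 T 𝔹 (W₁.cell n) (fun _ _ => G₀) F u) (hF : Integrable F volume) (s : Fin k₀) (K0 : Fin 3 → ℤ)
    {σ : ℝ} (hσ : σ = 1 ∨ σ = -1) (p : ℤ) (h0 : 0 ≤ p * W₁.period + W₁.start s) (h1 : p * W₁.period + W₁.start s + (W₁.phase s).τ ≤ T) :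
    ∀ᵐ t ∂(volume : Measure ℝ), t ∈ uIcc (p * W₁.period + W₁.start s) (p * W₁.period + W₁.start s + (W₁.phase s).τ) →
      HasDerivAt (fun x => ((σ : ℂ) * starRingEnd ℂ (Complex.exp ((W₁.phase s).φ * Complex.I))) ^ (0:ℤ) • modeRepθ W₁ n 𝔹 G₀ F u (K0 + (0:ℤ) • (fun i => (W₁.phase s).m i * (n : ℤ))) x)
        (dW0R ((σ * (∑ a, (W₁.phase s).e a * (K0 a : ℝ)) * (1 / (n : ℝ)) / (2 * ‖latticeVec (W₁.phase s).m‖)) * LatticeWord.trapezoid (p * W₁.period + W₁.start s) (W₁.phase s).τ W₁.ramp t) (Torus.twistFreq G₀ (K0 + (0:ℤ) • (fun i => (W₁.phase s).m i * (n : ℤ)))) (((σ : ℂ) * starRingEnd ℂ (Complex.exp ((W₁.phase s).φ * Complex.I))) ^ (1:ℤ) • modeRepθ W₁ n 𝔹 G₀ F u (K0 + (1:ℤ) • (fun i => (W₁.phase s).m i * (n : ℤ))) t) (((σ : ℂ) * starRingEnd ℂ (Complex.exp ((W₁.phase s).φ * Complex.I))) ^ (-1:ℤ) • modeRepθ W₁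 n 𝔹 G₀ F u (K0 + (-1:ℤ) • (fun i => (W₁.phase s).m i * (n : ℤ))) t)
          (((4 * Real.pi ^ 2 : ℝ) : ℂ) • Torus.transversalProjR (Torus.twistFreq G₀ (K0 + (0:ℤ) • (fun i => (W₁.phase s).m i * (n : ℤ)))) (Torus.symbT (Torus.majorTranspose (Torus.Visc4.conj G₀ 𝔹)) (K0 + (0:ℤ) • (fun i => (W₁.phase s).m i * (n : ℤ))) (((σ : ℂ) * starRingEnd ℂ (Complex.exp ((W₁.phase s).φ * Complex.I))) ^ (0:ℤ) • modeRepθ W₁ n 𝔹 G₀ F u (K0 + (0:ℤ) • (fun i => (W₁.phase s).m i * (n : ℤ))) t)))) t :=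
  ae_uIcc_of_ae_window h0 (by linarith [(W₁.phase s).τ_pos]) h1
    ((ae_hasDerivAt_window_dW0R_frame W₁ n hT h hF s K0 hσ).mono fun t ht hmem => ht p hmem)

/-- `hdp'` of `slot_step` on the window. [cite: BedrossianCotiZelati2017, §2 (hypocoercivity functional with a cross term)] -/
theorem ae_uIcc_hasDerivAt_dWpR_frame (W₁ : LatticeWord k₀) (n : ℕ) {T : ℝ} (hT : 0 ≤ T) {𝔹 : Torus.Visc4 (Fin 3)}
    {G₀ : Matrix (Fin 3) (Fin 3) ℝ} {F : UnitAddTorus (Fin 3) → EuclideanSpace ℝ (Fin 3)} {u : ℝ → UnitAddTorus (Fin 3) → EuclideanSpace ℝ (Fin 3)}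
    (h : Torus.IsWeakTensorPassiveVectorDistortedOn 0 T 𝔹 (W₁.cell n) (fun _ _ => G₀) F u) (hF : Integrable F volume) (s : Fin k₀) (K0 : Fin 3 → ℤ)
    {σ : ℝ} (hσ : σ = 1 ∨ σ = -1) (p : ℤ) (h0 : 0 ≤ p * W₁.period + W₁.start s) (h1 : p * W₁.period + W₁.start s + (W₁.phase s).τ ≤ T) :
    ∀ᵐ t ∂(volume : Measure ℝ), t ∈ uIcc (p * W₁.period + W₁.start s) (p * W₁.period + W₁.start s + (W₁.phase s).τ) →
      HasDerivAt (fun x => ((σ : ℂ) * starRingEnd ℂ (Complex.exp ((W₁.phase s).φ * Complex.I))) ^ (1:ℤ) • modeRepθ W₁ n 𝔹 G₀ F u (K0 + (1:ℤ) • (fun i => (W₁.phase s).m i * (n : ℤ))) x)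
        (dWpR ((σ * (∑ a, (W₁.phase s).e a * (K0 a : ℝ)) * (1 / (n : ℝ)) / (2 * ‖latticeVec (W₁.phase s).m‖)) * LatticeWord.trapezoid (p * W₁.period + W₁.start s) (W₁.phase s).τ W₁.ramp t) (Torus.twistFreq G₀ (K0 + (1:ℤ) • (fun i => (W₁.phase s).m i * (n : ℤ)))) (((σ : ℂ) * starRingEnd ℂ (Complex.exp ((W₁.phase s).φ * Complex.I))) ^ (0:ℤ) • modeRepθ W₁ n 𝔹 G₀ F u (K0 + (0:ℤ) • (fun i => (W₁.phase s).m i * (n : ℤ))) t) (((σ : ℂ) * starRingEnd ℂ (Complex.exp ((W₁.phase s).φ * Complex.I))) ^ (2:ℤ) • modeRepθ W₁ n 𝔹 G₀ F u (K0 + (2:ℤ) • (fun i => (W₁.phase s).m i * (n : ℤ))) t)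
          (((4 * Real.pi ^ 2 : ℝ) : ℂ) • Torus.transversalProjR (Torus.twistFreq G₀ (K0 + (1:ℤ) • (fun i => (W₁.phase s).m i * (n : ℤ)))) (Torus.symbT (Torus.majorTranspose (Torus.Visc4.conj G₀ 𝔹)) (K0 + (1:ℤ) • (fun i => (W₁.phase s).m i * (n : ℤ))) (((σ : ℂ) * starRingEnd ℂ (Complex.exp ((W₁.phase s).φ * Complex.I))) ^ (1:ℤ) • modeRepθ W₁ n 𝔹 G₀ F u (K0 + (1:ℤ) • (fun i => (W₁.phase s).m i * (n : ℤ))) t)))) t :=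
  ae_uIcc_of_ae_window h0 (by linarith [(W₁.phase s).τ_pos]) h1
    ((ae_hasDerivAt_window_dWpR_frame W₁ n hT h hF s K0 hσ).mono fun t ht hmem => ht p hmem)

/-- `hdm'` of `slot_step` on the window. [cite: BedrossianCotiZelati2017, §2 (hypocoercivity functional with a cross term)] -/
theorem ae_uIcc_hasDerivAt_dWmR_frame (W₁ : LatticeWord k₀) (n : ℕ) {T : ℝ} (hT : 0 ≤ T) {𝔹 : Torus.Visc4 (Fin 3)}
    {G₀ : Matrix (Fin 3) (Fin 3) ℝ} {F : UnitAddTorus (Fin 3) → EuclideanSpace ℝ (Fin 3)} {u : ℝ → UnitAddTorus (Fin 3) → EuclideanSpace ℝ (Fin 3)}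
    (h : Torus.IsWeakTensorPassiveVectorDistortedOn 0 T 𝔹 (W₁.cell n) (fun _ _ => G₀) F u) (hF : Integrable F volume) (s : Fin k₀) (K0 : Fin 3 → ℤ)
    {σ : ℝ} (hσ : σ = 1 ∨ σ = -1) (p : ℤ) (h0 : 0 ≤ p * W₁.period + W₁.start s) (h1 : p * W₁.period + W₁.start s + (W₁.phase s).τ ≤ T) :
    ∀ᵐ t ∂(volume : Measure ℝ), t ∈ uIcc (p * W₁.period + W₁.start s) (p * W₁.period + W₁.start s + (W₁.phase s).τ) →
      HasDerivAt (fun x => ((σ : ℂ) * starRingEnd ℂ (Complex.exp ((W₁.phase s).φ * Complex.I))) ^ (-1:ℤ) • modeRepθ W₁ n 𝔹 G₀ F u (K0 + (-1:ℤ) • (fun i => (W₁.phase s).m i * (n : ℤ))) x)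
        (dWmR ((σ * (∑ a, (W₁.phase s).e a * (K0 a : ℝ)) * (1 / (n : ℝ)) / (2 * ‖latticeVec (W₁.phase s).m‖)) * LatticeWord.trapezoid (p * W₁.period + W₁.start s) (W₁.phase s).τ W₁.ramp t) (Torus.twistFreq G₀ (K0 + (-1:ℤ) • (fun i => (W₁.phase s).m i * (n : ℤ)))) (((σ : ℂ) * starRingEnd ℂ (Complex.exp ((W₁.phase s).φ * Complex.I))) ^ (0:ℤ) • modeRepθ W₁ n 𝔹 G₀ F u (K0 + (0:ℤ) • (fun i => (W₁.phase s).m i * (n : ℤ))) t) (((σ : ℂ) * starRingEnd ℂ (Complex.exp ((W₁.phase s).φ * Complex.I))) ^ (-2:ℤ) • modeRepθ W₁ n 𝔹 G₀ F u (K0 + (-2:ℤ) • (fun i => (W₁.phase s).m i * (n : ℤ))) t)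
          (((4 * Real.pi ^ 2 : ℝ) : ℂ) • Torus.transversalProjR (Torus.twistFreq G₀ (K0 + (-1:ℤ) • (fun i => (W₁.phase s).m i * (n : ℤ)))) (Torus.symbT (Torus.majorTranspose (Torus.Visc4.conj G₀ 𝔹)) (K0 + (-1:ℤ) • (fun i => (W₁.phase s).m i * (n : ℤ))) (((σ : ℂ) * starRingEnd ℂ (Complex.exp ((W₁.phase s).φ * Complex.I))) ^ (-1:ℤ) • modeRepθ W₁ n 𝔹 G₀ F u (K0 + (-1:ℤ) • (fun i => (W₁.phase s).m i * (n : ℤ))) t)))) t :=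
  ae_uIcc_of_ae_window h0 (by linarith [(W₁.phase s).τ_pos]) h1
    ((ae_hasDerivAt_window_dWmR_frame W₁ n hT h hF s K0 hσ).mono fun t ht hmem => ht p hmem)

/-! ## §4 The five-mode energy sandwich everywhere on `[0,T]` (slot_stepR's `hE5`, multiplicity `2`) -/

/-- **`hE5` of `slot_step` with multiplicity `2`, EVERYWHERE on `[0,T]`**: `2·Σ_{j∈{0,±1,±2}} ‖w̃ⱼ t‖² ≤ E t` for all `t ∈ [0,T]`
(a.e. by finite Bessel + reality + gauge, then everywhere by continuity of both sides). [cite: Grafakos2014, Prop. 3.2.7 (3)] -/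
theorem five_norm_sq_le_energy_frame (W₁ : LatticeWord k₀) (n : ℕ) {T : ℝ} (hT : 0 < T) {𝔹 : Torus.Visc4 (Fin 3)}
    {G₀ : Matrix (Fin 3) (Fin 3) ℝ} {F : UnitAddTorus (Fin 3) → EuclideanSpace ℝ (Fin 3)} {u : ℝ → UnitAddTorus (Fin 3) → EuclideanSpace ℝ (Fin 3)}
    (h : Torus.IsWeakTensorPassiveVectorDistortedOn 0 T 𝔹 (W₁.cell n) (fun _ _ => G₀) F u) (hF : Integrable F volume) (s : Fin k₀) (K0 : Fin 3 → ℤ)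
    {σ : ℝ} (hσ : σ = 1 ∨ σ = -1) (hKs : (fun i => (W₁.phase s).m i * (n : ℤ)) ≠ 0)
    (hdisj : ∀ j ∈ ({-2, -1, 0, 1, 2} : Finset ℤ), ∀ j' ∈ ({-2, -1, 0, 1, 2} : Finset ℤ),
      K0 + j • (fun i => (W₁.phase s).m i * (n : ℤ)) ≠ -(K0 + j' • (fun i => (W₁.phase s).m i * (n : ℤ))))
    {E : ℝ → ℝ} (hEc : ContinuousOn E (Icc 0 T)) (hE : ∀ᵐ t ∂(volume.restrict (Ioo 0 T)), E t = ∫ x, ‖u t x‖ ^ 2) :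
    ∀ t ∈ Icc 0 T, 2 * (‖((σ : ℂ) * starRingEnd ℂ (Complex.exp ((W₁.phase s).φ * Complex.I))) ^ (0:ℤ) • modeRepθ W₁ n 𝔹 G₀ F u (K0 + (0:ℤ) • (fun i => (W₁.phase s).m i * (n : ℤ))) t‖ ^ 2 + ‖((σ : ℂ) * starRingEnd ℂ (Complex.exp ((W₁.phase s).φ * Complex.I))) ^ (1:ℤ) • modeRepθ W₁ n 𝔹 G₀ F u (K0 + (1:ℤ) • (fun i => (W₁.phase s).m i * (n : ℤ))) t‖ ^ 2 + ‖((σ : ℂ) * starRingEnd ℂ (Complex.exp ((W₁.phase s).φ * Complex.I))) ^ (-1:ℤ) • modeRepθ W₁ n 𝔹 G₀ F u (K0 + (-1:ℤ) • (fun i => (W₁.phase s).m i * (n : ℤ))) t‖ ^ 2 + ‖((σ : ℂ) * starRingEnd ℂ (Complex.exp ((W₁.phase s).φ * Complex.I))) ^ (2:ℤ) • modeRepθ W₁ n 𝔹 G₀ F u (K0 + (2:ℤ) • (fun i => (W₁.phase s).m i * (n : ℤ))) t‖ ^ 2 + ‖((σ : ℂ) * starRingEnd ℂ (Complex.exp ((W₁.phase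 s).φ * Complex.I))) ^ (-2:ℤ) • modeRepθ W₁ n 𝔹 G₀ F u (K0 + (-2:ℤ) • (fun i => (W₁.phase s).m i * (n : ℤ))) t‖ ^ 2) ≤ E t := by
  classical
  set S5 : Finset ℤ := ({-2, -1, 0, 1, 2} : Finset ℤ) with hS5
  set W10 : Finset (Fin 3 → ℤ) := S5.image (fun j : ℤ => K0 + j • (fun i => (W₁.phase s).m i * (n : ℤ))) ∪ S5.image (fun j : ℤ => -(K0 + j • (fun i => (W₁.phase s).m i * (n : ℤ)))) with hW10
  -- a.e. on `(0,T)`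
  have hae : ∀ᵐ t ∂(volume.restrict (Ioo 0 T)), 2 * (‖((σ : ℂ) * starRingEnd ℂ (Complex.exp ((W₁.phase s).φ * Complex.I))) ^ (0:ℤ) • modeRepθ W₁ n 𝔹 G₀ F u (K0 + (0:ℤ) • (fun i => (W₁.phase s).m i * (n : ℤ))) t‖ ^ 2 + ‖((σ : ℂ) * starRingEnd ℂ (Complex.exp ((W₁.phase s).φ * Complex.I))) ^ (1:ℤ) • modeRepθ W₁ n 𝔹 G₀ F u (K0 + (1:ℤ) • (fun i => (W₁.phase s).m i * (n : ℤ))) t‖ ^ 2 + ‖((σ : ℂ) * starRingEnd ℂ (Complex.exp ((W₁.phase s).φ * Complex.I))) ^ (-1:ℤ) • modeRepθ W₁ n 𝔹 G₀ F u (K0 + (-1:ℤ) • (fun i => (W₁.phase s).m i * (n : ℤ))) t‖ ^ 2 + ‖((σ : ℂ) * starRingEnd ℂ (Complex.exp ((W₁.phase s).φ * Complex.I))) ^ (2:ℤ) • modeRepθ W₁ n 𝔹 G₀ F u (K0 + (2:ℤ) • (fun i => (W₁.phase s).m i * (n : ℤ))) t‖ ^ 2 + ‖((σ : ℂ) * starRingEnd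 ℂ (Complex.exp ((W₁.phase s).φ * Complex.I))) ^ (-2:ℤ) • modeRepθ W₁ n 𝔹 G₀ F u (K0 + (-2:ℤ) • (fun i => (W₁.phase s).m i * (n : ℤ))) t‖ ^ 2) ≤ E t := by
    filter_upwards [sum_sq_norm_mFourierCoeff_le_frame W₁ n h W10, ae_forall_eq_modeRepθ W₁ n hT.le h hF, hE, h.ae_integrable_slice]
      with t hB hrep hEt hint
    rw [hW10, sum_window_pair_eq hKs hdisj _ (fun k => by rw [norm_mFourierCoeff_neg hint.1]), hEt.symm] at hB
    simp only [hrep] at hB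
    have e : ∑ j ∈ ({-2, -1, 0, 1, 2} : Finset ℤ), ‖modeRepθ W₁ n 𝔹 G₀ F u (K0 + j • (fun i => (W₁.phase s).m i * (n : ℤ))) t‖ ^ 2 =
        ∑ j ∈ ({-2, -1, 0, 1, 2} : Finset ℤ), ‖((σ : ℂ) * starRingEnd ℂ (Complex.exp ((W₁.phase s).φ * Complex.I))) ^ j • modeRepθ W₁ n 𝔹 G₀ F u (K0 + j • (fun i => (W₁.phase s).m i * (n : ℤ))) t‖ ^ 2 :=
      Finset.sum_congr rfl fun j _ => by rw [norm_zpow_gauge_smul hσ]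
    rw [e, sum_S5_eq (fun j => ‖((σ : ℂ) * starRingEnd ℂ (Complex.exp ((W₁.phase s).φ * Complex.I))) ^ j • modeRepθ W₁ n 𝔹 G₀ F u (K0 + j • (fun i => (W₁.phase s).m i * (n : ℤ))) t‖ ^ 2)] at hB
    exact hB
  -- everywhere by continuity
  have hc5 : ContinuousOn (fun t => 2 * (‖((σ : ℂ) * starRingEnd ℂ (Complex.exp ((W₁.phase s).φ * Complex.I))) ^ (0:ℤ) • modeRepθ W₁ n 𝔹 G₀ F u (K0 + (0:ℤ) • (fun i => (W₁.phase s).m i * (n : ℤ))) t‖ ^ 2 + ‖((σ : ℂ) * starRingEnd ℂ (Complex.exp ((W₁.phase s).φ * Complex.I))) ^ (1:ℤ) • modeRepθ W₁ n 𝔹 G₀ F u (K0 + (1:ℤ) • (fun i => (W₁.phase s).m i * (n : ℤ))) t‖ ^ 2 + ‖((σ : ℂ) * starRingEnd ℂ (Complex.exp ((W₁.phase s).φ * Complex.I))) ^ (-1:ℤ) • modeRepθ W₁ n 𝔹 G₀ F u (K0 + (-1:ℤ) • (fun i => (W₁.phase s).m i * (n : ℤ))) t‖ ^ 2 + ‖((σ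 : ℂ) * starRingEnd ℂ (Complex.exp ((W₁.phase s).φ * Complex.I))) ^ (2:ℤ) • modeRepθ W₁ n 𝔹 G₀ F u (K0 + (2:ℤ) • (fun i => (W₁.phase s).m i * (n : ℤ))) t‖ ^ 2 + ‖((σ : ℂ) * starRingEnd ℂ (Complex.exp ((W₁.phase s).φ * Complex.I))) ^ (-2:ℤ) • modeRepθ W₁ n 𝔹 G₀ F u (K0 + (-2:ℤ) • (fun i => (W₁.phase s).m i * (n : ℤ))) t‖ ^ 2)) (Icc 0 T) := by
    refine continuousOn_const.mul ?_
    exact ((((continuousOn_norm_sq_gauge_modeRepθ W₁ n hT.le h _ _).add (continuousOn_norm_sq_gauge_modeRepθ W₁ n hT.le h _ _)).add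
      (continuousOn_norm_sq_gauge_modeRepθ W₁ n hT.le h _ _)).add (continuousOn_norm_sq_gauge_modeRepθ W₁ n hT.le h _ _)).add
      (continuousOn_norm_sq_gauge_modeRepθ W₁ n hT.le h _ _)
  exact le_on_Icc_of_ae_le hT hc5 hEc hae

/-! ## §5 The conjugate-pair dissipation split on `uIcc t₀ t₁` (slot_stepR's `hQ`, multiplicity `2`) -/

/-- **`hQ` of `slot_step` (μ = 2), frozen frame** on the window `[t₀,t₁] ⊆ [0,T]`, in its five-term order. [cite: BedrossianCotiZelati2017, §2 (hypocoercivity functional with a cross term)] -/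
theorem ae_uIcc_pair_split_frame (W₁ : LatticeWord k₀) (n : ℕ) {T : ℝ} (hT : 0 ≤ T) {𝔹 : Torus.Visc4 (Fin 3)}
    {G₀ : Matrix (Fin 3) (Fin 3) ℝ} {F : UnitAddTorus (Fin 3) → EuclideanSpace ℝ (Fin 3)} {u : ℝ → UnitAddTorus (Fin 3) → EuclideanSpace ℝ (Fin 3)}
    (h : Torus.IsWeakTensorPassiveVectorDistortedOn 0 T 𝔹 (W₁.cell n) (fun _ _ => G₀) F u) (hF : Integrable F volume) {loc : ℝ} (s : Fin k₀) (K0 : Fin 3 → ℤ) {σ : ℝ} (hσ : σ = 1 ∨ σ = -1) (hKs : (fun i => (W₁.phase s).m i * (n : ℤ)) ≠ 0)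
    (hdisj : ∀ j ∈ ({-2, -1, 0, 1, 2} : Finset ℤ), ∀ j' ∈ ({-2, -1, 0, 1, 2} : Finset ℤ),
      K0 + j • (fun i => (W₁.phase s).m i * (n : ℤ)) ≠ -(K0 + j' • (fun i => (W₁.phase s).m i * (n : ℤ))))
    {E Q : ℝ → ℝ} (hE : ∀ᵐ t ∂(volume.restrict (Ioo 0 T)), E t = ∫ x, ‖u t x‖ ^ 2)
    (hQ : ∀ᵐ t ∂(volume.restrict (Ioo 0 T)), ∀ S : Finset (Fin 3 → ℤ),
      4 * Real.pi ^ 2 * ∑ k ∈ S, (⟪mFourierCoeff (EuclideanSpace.complexify ∘ u t) k,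
        Torus.symbT (Torus.Visc4.conj G₀ 𝔹) k (mFourierCoeff (EuclideanSpace.complexify ∘ u t) k)⟫_ℂ).re ≤ Q t)
    (hcoer : ∀ᵐ t ∂(volume.restrict (Ioo 0 T)), ∀ k : Fin 3 → ℤ,
      loc * (freqNormSq k * ‖mFourierCoeff (EuclideanSpace.complexify ∘ u t) k‖ ^ 2) ≤
        (⟪mFourierCoeff (EuclideanSpace.complexify ∘ u t) k, Torus.symbT (Torus.Visc4.conj G₀ 𝔹) k (mFourierCoeff (EuclideanSpace.complexify ∘ u t) k)⟫_ℂ).re)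
    {dmin : ℝ} (hdmin : 0 ≤ dmin)
    (hgap : ∀ᵐ t ∂(volume.restrict (Ioo 0 T)), ∀ k : Fin 3 → ℤ,
      (∀ j ∈ ({-2, -1, 0, 1, 2} : Finset ℤ), k ≠ K0 + j • (fun i => (W₁.phase s).m i * (n : ℤ)) ∧ k ≠ -(K0 + j • (fun i => (W₁.phase s).m i * (n : ℤ)))) →
      mFourierCoeff (EuclideanSpace.complexify ∘ u t) k ≠ 0 → dmin ≤ 8 * Real.pi ^ 2 * loc * freqNormSq k)
    {t₀ t₁ : ℝ} (h0 : 0 ≤ t₀) (h01 : t₀ ≤ t₁) (h1 : t₁ ≤ T) :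
    ∀ᵐ t ∂(volume : Measure ℝ), t ∈ uIcc t₀ t₁ →
      2 * ((⟪((4 * Real.pi ^ 2 : ℝ) : ℂ) • Torus.transversalProjR (Torus.twistFreq G₀ (K0 + (0:ℤ) • (fun i => (W₁.phase s).m i * (n : ℤ)))) (Torus.symbT (Torus.majorTranspose (Torus.Visc4.conj G₀ 𝔹)) (K0 + (0:ℤ) • (fun i => (W₁.phase s).m i * (n : ℤ))) (((σ : ℂ) * starRingEnd ℂ (Complex.exp ((W₁.phase s).φ * Complex.I))) ^ (0:ℤ) • modeRepθ W₁ n 𝔹 G₀ F u (K0 + (0:ℤ) • (fun i => (W₁.phase s).m i * (n : ℤ))) t)), ((σ : ℂ) * starRingEnd ℂ (Complex.exp ((W₁.phase s).φ * Complex.I))) ^ (0:ℤ) • modeRepθ W₁ n 𝔹 G₀ F u (K0 + (0:ℤ) • (fun i => (W₁.phase s).m i * (n : ℤ))) t⟫_ℂ).re + (⟪((4 * Real.pi ^ 2 : ℝ) : ℂ) • Torus.transversalProjR (Torus.twistFreq G₀ (K0 + (1:ℤ) • (fun i => (W₁.phase s).m i * (n : ℤ)))) (Torus.symbT (Torus.majorTranspose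 (Torus.Visc4.conj G₀ 𝔹)) (K0 + (1:ℤ) • (fun i => (W₁.phase s).m i * (n : ℤ))) (((σ : ℂ) * starRingEnd ℂ (Complex.exp ((W₁.phase s).φ * Complex.I))) ^ (1:ℤ) • modeRepθ W₁ n 𝔹 G₀ F u (K0 + (1:ℤ) • (fun i => (W₁.phase s).m i * (n : ℤ))) t)), ((σ : ℂ) * starRingEnd ℂ (Complex.exp ((W₁.phase s).φ * Complex.I))) ^ (1:ℤ) • modeRepθ W₁ n 𝔹 G₀ F u (K0 + (1:ℤ) • (fun i => (W₁.phase s).m i * (n : ℤ))) t⟫_ℂ).re + (⟪((4 * Real.pi ^ 2 : ℝ) : ℂ) • Torus.transversalProjR (Torus.twistFreq G₀ (K0 + (-1:ℤ) • (fun i => (W₁.phase s).m i * (n : ℤ)))) (Torus.symbT (Torus.majorTranspose (Torus.Visc4.conj G₀ 𝔹)) (K0 + (-1:ℤ) • (fun i => (W₁.phase s).m i * (n : ℤ))) (((σ : ℂ) * starRingEnd ℂ (Complex.exp ((W₁.phase s).φ * Complex.I))) ^ (-1:ℤ) • modeRepθ W₁ n 𝔹 G₀ F u (K0 + (-1:ℤ)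 • (fun i => (W₁.phase s).m i * (n : ℤ))) t)), ((σ : ℂ) * starRingEnd ℂ (Complex.exp ((W₁.phase s).φ * Complex.I))) ^ (-1:ℤ) • modeRepθ W₁ n 𝔹 G₀ F u (K0 + (-1:ℤ) • (fun i => (W₁.phase s).m i * (n : ℤ))) t⟫_ℂ).re + (⟪((4 * Real.pi ^ 2 : ℝ) : ℂ) • Torus.transversalProjR (Torus.twistFreq G₀ (K0 + (2:ℤ) • (fun i => (W₁.phase s).m i * (n : ℤ)))) (Torus.symbT (Torus.majorTranspose (Torus.Visc4.conj G₀ 𝔹)) (K0 + (2:ℤ) • (fun i => (W₁.phase s).m i * (n : ℤ))) (((σ : ℂ) * starRingEnd ℂ (Complex.exp ((W₁.phase s).φ * Complex.I))) ^ (2:ℤ) • modeRepθ W₁ n 𝔹 G₀ F u (K0 + (2:ℤ) • (fun i => (W₁.phase s).m i * (n : ℤ))) t)), ((σ : ℂ) * starRingEnd ℂ (Complex.exp ((W₁.phase s).φ * Complex.I))) ^ (2:ℤ) • modeRepθ W₁ n 𝔹 G₀ F u (K0 + (2:ℤ) • (fun i => (W₁.phase s).m i * (n : ℤ))) t⟫_ℂ).re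 + (⟪((4 * Real.pi ^ 2 : ℝ) : ℂ) • Torus.transversalProjR (Torus.twistFreq G₀ (K0 + (-2:ℤ) • (fun i => (W₁.phase s).m i * (n : ℤ)))) (Torus.symbT (Torus.majorTranspose (Torus.Visc4.conj G₀ 𝔹)) (K0 + (-2:ℤ) • (fun i => (W₁.phase s).m i * (n : ℤ))) (((σ : ℂ) * starRingEnd ℂ (Complex.exp ((W₁.phase s).φ * Complex.I))) ^ (-2:ℤ) • modeRepθ W₁ n 𝔹 G₀ F u (K0 + (-2:ℤ) • (fun i => (W₁.phase s).m i * (n : ℤ))) t)), ((σ : ℂ) * starRingEnd ℂ (Complex.exp ((W₁.phase s).φ * Complex.I))) ^ (-2:ℤ) • modeRepθ W₁ n 𝔹 G₀ F u (K0 + (-2:ℤ) • (fun i => (W₁.phase s).m i * (n : ℤ))) t⟫_ℂ).re) + dmin / 2 * (E t - 2 * (‖((σ : ℂ) * starRingEnd ℂ (Complex.exp ((W₁.phase s).φ * Complex.I))) ^ (0:ℤ) • modeRepθ W₁ n 𝔹 G₀ F u (K0 + (0:ℤ) • (fun i => (W₁.phase s).m i * (n : ℤ))) t‖ ^ 2 +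 ‖((σ : ℂ) * starRingEnd ℂ (Complex.exp ((W₁.phase s).φ * Complex.I))) ^ (1:ℤ) • modeRepθ W₁ n 𝔹 G₀ F u (K0 + (1:ℤ) • (fun i => (W₁.phase s).m i * (n : ℤ))) t‖ ^ 2 + ‖((σ : ℂ) * starRingEnd ℂ (Complex.exp ((W₁.phase s).φ * Complex.I))) ^ (-1:ℤ) • modeRepθ W₁ n 𝔹 G₀ F u (K0 + (-1:ℤ) • (fun i => (W₁.phase s).m i * (n : ℤ))) t‖ ^ 2 + ‖((σ : ℂ) * starRingEnd ℂ (Complex.exp ((W₁.phase s).φ * Complex.I))) ^ (2:ℤ) • modeRepθ W₁ n 𝔹 G₀ F u (K0 + (2:ℤ) • (fun i => (W₁.phase s).m i * (n : ℤ))) t‖ ^ 2 + ‖((σ : ℂ) * starRingEnd ℂ (Complex.exp ((W₁.phase s).φ * Complex.I))) ^ (-2:ℤ) • modeRepθ W₁ n 𝔹 G₀ F u (K0 + (-2:ℤ) • (fun i => (W₁.phase s).m i * (n : ℤ))) t‖ ^ 2)) ≤ Q t := by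
  have hsplit := ae_pair_dissipation_split_rep_frame W₁ n hT h hF hE hQ hcoer K0 (fun i => (W₁.phase s).m i * (n : ℤ)) hKs hdisj hσ (W₁.phase s).φ hdmin hgap
  refine ae_uIcc_of_ae_Ioo h0 h01 h1 (hsplit.mono fun t ht => ?_)
  rw [sum_S5_eq, sum_S5_eq] at ht
  exact ht

end Summit.AnomalousDissipation.AnomalousDissipation.Theorems.SolenoidalFractalHomogenisation.LagrangianStep.CellChain

end
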